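import Mathlib.NumberTheory.RamificationInertia.Galois

/-!
# Degree-one primes and complete splitting in a Galois tower (the arithmetic of N0 (D6))

The Tier-5 datum (route/T5-N0-p5.md v5, (D6)) fixes a prime `𝔭` of the cubic field `F` by the
condition «absolute local degree `[F_𝔭 : ℚ_p] = e·f = 1` and `𝔭` split in the sextic `E`», and
records that this is equivalent to «`p` splits completely in the Galois sextic `E`» and implies
`p ∤ D_F`.  This file kernel-checks the purely arithmetic content of that sentence, in the
generality of Mathlib's Hilbert ramification theory for Galois extensions of Dedekind domains:

* `ef_eq_one_iff_splits_completely`: for a Galois extension `B / A` with group `G`,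
  `e · f = 1` for a prime `p` of `A` if and only if the number of primes of `B` above `p` is
  `|G|` (the fundamental identity `r · (e · f) = |G|`, `Ideal.ncard_primesOver_mul_ramificationIdxIn_mul_inertiaDegIn`).
* `ef_eq_one_iff_unramified_and_inert_deg_one`: `e · f = 1 ↔ e = 1 ∧ f = 1` — in particular a
  degree-one prime is unramified (`p ∤ D_F` in the prose).
* `ef_tower`: in a tower `A ⊆ B ⊆ C` of Galois extensions, `(e f)(p, C) = (e f)(p, B) · (e f)(P, C)`
  for any prime `P` of `B` above `p` (Mathlib's `inertiaDegIn_mul_inertiaDegIn` and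
  `ramificationIdxIn_mul_ramificationIdxIn`).
* `ef_eq_one_iff_ef_eq_one_and_ef_eq_one`: the (D6) equivalence — `p` has `e f = 1` in `C`
  if and only if `p` has `e f = 1` in `B` AND `P` has `e f = 1` in `C`.
* `splits_completely_iff`: the (D6) sentence itself: `p` splits completely in `C` ⟺
  `[B_P : A_p]`-degree one (`e f = 1` in `B`) and `P` splits in `C` (`e f = 1` in `C/B`).

Nothing about number fields, local degrees as field degrees, or Chebotarev is asserted; the
dictionary «`[F_𝔭 : ℚ_p] = e(𝔭/p) · f(𝔭/p)`» and «`p ∤ D_F ⟺ e = 1`» stays in the prose (N0 (D6)).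
Instantiation in the prose: `A = ℤ`, `B = O_F` (cubic Galois), `C = O_E` (sextic Galois CM).
-/

namespace Summit.Ventures.HodgeRepro2.T5DegreeOne

open Ideal

/-- `m · n = 1 ↔ m = 1 ∧ n = 1` in `ℕ` (from the core lemmas `Nat.eq_one_of_mul_eq_one_right/left`). -/
theorem nat_mul_eq_one_iff {m n : ℕ} : m * n = 1 ↔ m = 1 ∧ n = 1 :=
  ⟨fun h => ⟨Nat.eq_one_of_mul_eq_one_right h, Nat.eq_one_of_mul_eq_one_left h⟩,
    fun ⟨h1, h2⟩ => by rw [h1, h2]⟩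

section base

variable {A : Type*} [CommRing A] [IsDomain A] (p : Ideal A) [p.IsPrime]
  (B : Type*) [CommRing B] [IsDomain B] [Algebra A B] [Module.Finite A B] [Module.Flat A B]
  [FaithfulSMul A B]
  (G : Type*) [Group G] [Finite G] [MulSemiringAction G B] [IsGaloisGroup G A B]

/-- The product `e · f` of the ramification index and the inertia degree of `p` in the Galois
extension `B / A` (well defined by `Ideal.ramificationIdx_eq_of_isGaloisGroup` /
`Ideal.inertiaDeg_eq_of_isGaloisGroup`); in the prose this is the absolute local degree
`[B_P : A_p]` of any prime `P` above `p`. -/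
noncomputable def ef : ℕ := ramificationIdxIn p B * inertiaDegIn p B

omit [IsDomain A] [IsDomain B] [Module.Flat A B] in
include G in
/-- `e · f ≠ 0` (both factors are positive in a finite extension of domains). -/
theorem ef_ne_zero : ef p B ≠ 0 := by
  unfold ef
  exact mul_ne_zero (ramificationIdxIn_ne_zero G) (inertiaDegIn_ne_zero G)

omit [FaithfulSMul A B] in
/-- The fundamental identity in the Galois case, in the notation of this file:
`r · (e · f) = |G|`. -/
theorem ncard_primesOver_mul_ef : (primesOver p B).ncard * ef p B = Nat.card G :=
  ncard_primesOver_mul_ramificationIdxIn_mul_inertiaDegIn p B G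

omit [FaithfulSMul A B] in
/-- `e · f = 1` if and only if `p` splits completely, i.e. the number of primes of `B` above `p`
equals the degree `|G|` of the extension. -/
theorem ef_eq_one_iff_splits_completely :
    ef p B = 1 ↔ (primesOver p B).ncard = Nat.card G := by
  have h := ncard_primesOver_mul_ef p B G
  constructor
  · intro h1
    rw [h1, mul_one] at h
    exact h
  · intro hr
    rw [hr] at h
    have hG : Nat.card G ≠ 0 := Nat.card_pos.ne'
    exact (Nat.eq_of_mul_eq_mul_left (Nat.pos_of_ne_zero hG) (by rw [h, mul_one]))

omit [IsDomain A] [p.IsPrime] [IsDomain B] [Module.Finite A B] [Module.Flat A B]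
  [FaithfulSMul A B] in
/-- `e · f = 1` if and only if `e = 1` and `f = 1`: a degree-one prime is unramified and has
residue degree one. -/
theorem ef_eq_one_iff_unramified_and_inert_deg_one :
    ef p B = 1 ↔ ramificationIdxIn p B = 1 ∧ inertiaDegIn p B = 1 := by
  unfold ef
  exact nat_mul_eq_one_iff

omit [IsDomain A] [p.IsPrime] [IsDomain B] [Module.Finite A B] [Module.Flat A B]
  [FaithfulSMul A B] in
/-- A degree-one prime is unramified (`e = 1`): the «`p ∤ D_F`» consequence recorded in (D6). -/
theorem ramificationIdxIn_eq_one_of_ef_eq_one (h : ef p B = 1) : ramificationIdxIn p B = 1 :=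
  ((ef_eq_one_iff_unramified_and_inert_deg_one p B).1 h).1

end base

section tower

variable {A B : Type*} [CommRing A] [IsDomain A] [CommRing B] [IsDomain B] [Algebra A B]
  [FaithfulSMul A B] (p : Ideal A) [p.IsPrime] (P : Ideal B) [P.IsPrime] [P.LiesOver p]
  (G : Type*) [Group G] [Finite G] [MulSemiringAction G B] [IsGaloisGroup G A B]
  (C : Type*) [CommRing C] [IsDomain C] [Algebra A C] [Algebra B C] [IsScalarTower A B C]
  [Nonempty (P.primesOver C)] [Module.Flat B C]
  (GAC : Type*) [Group GAC] [Finite GAC] [MulSemiringAction GAC C] [IsGaloisGroup GAC A C]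
  (GBC : Type*) [Group GBC] [Finite GBC] [MulSemiringAction GBC C] [IsGaloisGroup GBC B C]

omit [IsDomain A] [IsDomain B] [FaithfulSMul A B] [p.IsPrime] [IsDomain C] in
include G GAC GBC in
/-- Multiplicativity of `e · f` in a tower of Galois extensions: `(ef)(p, C) = (ef)(p, B) · (ef)(P, C)`
for any prime `P` of `B` above `p`. -/
theorem ef_tower : ef p C = ef p B * ef P C := by
  unfold ef
  rw [← inertiaDegIn_mul_inertiaDegIn p P G C GAC GBC,
    ← ramificationIdxIn_mul_ramificationIdxIn P G C GAC GBC]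
  ring

omit [IsDomain A] [IsDomain B] [FaithfulSMul A B] [p.IsPrime] [IsDomain C] in
include G GAC GBC in
/-- The (D6) equivalence: `p` is of degree one in `C` if and only if `p` is of degree one in `B`
and `P` (a prime of `B` above `p`) is of degree one in `C`. -/
theorem ef_eq_one_iff_ef_eq_one_and_ef_eq_one :
    ef p C = 1 ↔ ef p B = 1 ∧ ef P C = 1 := by
  rw [ef_tower p P G C GAC GBC]
  exact nat_mul_eq_one_iff

variable [Module.Finite A C] [Module.Flat A C] [FaithfulSMul A C]

omit [IsDomain B] [FaithfulSMul A B] [FaithfulSMul A C] in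
include G GBC in
/-- The sentence of N0 (D6): `p` splits completely in `C` (the number of primes of `C` above `p`
is `|Gal(C/A)|`) if and only if `p` has degree one in `B` and the prime `P` of `B` above `p`
has degree one in `C`. In the prose: `A = ℤ`, `B = O_F`, `C = O_E`, `P = 𝔭`:
«`[F_𝔭 : ℚ_p] = 1` and `𝔭` split in `E`» ⟺ «`p` splits completely in `E`». -/
theorem splits_completely_iff :
    (primesOver p C).ncard = Nat.card GAC ↔ ef p B = 1 ∧ ef P C = 1 := by
  rw [← ef_eq_one_iff_splits_completely p C GAC]
  exact ef_eq_one_iff_ef_eq_one_and_ef_eq_one p P G C GAC GBC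

end tower

end Summit.Ventures.HodgeRepro2.T5DegreeOne
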